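import Summits.Ventures.PercRepro.SixNineAll

/-!
# C-005 for every simple graph on six vertices with at most ten edges, for EVERY choice of marks

`C005At_six_of_card_le_ten` (`SixNineAll.lean`) has the marks at `0, 1, 2, 3`. Four distinct marks
`a, b, c, d` are moved there by a permutation of the vertices (`markPerm`, a product of four
transpositions), the relabelled graph `G.relabelV φ` is simple and isomorphic to `G`
(`isIso_relabelV`), and C-005 transports back along the isomorphism (`IsIso.c005At_of`). When two
marks coincide the two pairings separating them are empty events (`prob_partitionEvent_eq_zero_of_eq`)
and the left side of C-005 vanishes (`C005At_of_not_distinct`). **`C005At_six_all_marks`**: every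
simple graph on six vertices with at most ten edges satisfies C-005 at every weight vector for every
four marked vertices.
-/

namespace PercRepro

namespace MultiGraph

open Finset

variable {V E V' : Type}

/-! ### Relabelling the vertices -/

/-- The graph with the vertices relabelled by `φ` (the edges unchanged). -/
def relabelV (G : MultiGraph V E) (φ : V ≃ V') : MultiGraph V' E := ⟨φ ∘ G.fst, φ ∘ G.snd⟩

/-- `G` and its relabelling are isomorphic (identity on the edges). -/
theorem isIso_relabelV (G : MultiGraph V E) (φ : V ≃ V') :
    G.IsIso (G.relabelV φ) φ (Equiv.refl E) := fun _ => Or.inl ⟨rfl, rfl⟩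

/-- A relabelling of a simple graph is simple. -/
theorem IsSimple.relabelV {G : MultiGraph V E} (hG : G.IsSimple) (φ : V ≃ V') :
    (G.relabelV φ).IsSimple := by
  refine ⟨fun e h => hG.1 e (φ.injective h), fun e e' h => hG.2 e e' ?_⟩
  rcases h with ⟨h1, h2⟩ | ⟨h1, h2⟩
  · exact Or.inl ⟨φ.injective h1, φ.injective h2⟩
  · exact Or.inr ⟨φ.injective h1, φ.injective h2⟩

/-- C-005 transports to a relabelling of the vertices. -/
theorem C005At_relabelV_iff (G : MultiGraph V E) [Fintype E] [DecidableEq E] (φ : V ≃ V')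
    (p : E → ℝ) (a b c d : V) :
    (G.relabelV φ).C005At p (φ a) (φ b) (φ c) (φ d) ↔ G.C005At p a b c d := by
  rw [(G.isIso_relabelV φ).c005At_iff]
  rfl

/-! ### A permutation moving four distinct vertices to `0, 1, 2, 3` -/

/-- The permutation of `Fin 6` sending `a, b, c, d` to `0, 1, 2, 3`: four transpositions in turn. -/
def markPerm (a b c d : Fin 6) : Equiv.Perm (Fin 6) :=
  let φ₁ := Equiv.swap a 0
  let φ₂ := Equiv.swap (φ₁ b) 1
  let φ₃ := Equiv.swap (φ₂ (φ₁ c)) 2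
  let φ₄ := Equiv.swap (φ₃ (φ₂ (φ₁ d))) 3
  φ₄ * φ₃ * φ₂ * φ₁

/-- `markPerm` moves the four distinct marks to `0, 1, 2, 3`. -/
theorem markPerm_apply (a b c d : Fin 6) (hab : a ≠ b) (hac : a ≠ c) (had : a ≠ d) (hbc : b ≠ c)
    (hbd : b ≠ d) (hcd : c ≠ d) :
    markPerm a b c d a = 0 ∧ markPerm a b c d b = 1 ∧ markPerm a b c d c = 2 ∧
      markPerm a b c d d = 3 := by
  simp only [markPerm, Equiv.Perm.mul_apply]
  set φ₁ := Equiv.swap a 0 with hφ₁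
  have h1a : φ₁ a = 0 := Equiv.swap_apply_left a 0
  have h1b : φ₁ b ≠ 0 := fun h => hab (φ₁.injective (h1a.trans h.symm))
  have h1c : φ₁ c ≠ 0 := fun h => hac (φ₁.injective (h1a.trans h.symm))
  have h1d : φ₁ d ≠ 0 := fun h => had (φ₁.injective (h1a.trans h.symm))
  have h1bc : φ₁ b ≠ φ₁ c := fun h => hbc (φ₁.injective h)
  have h1bd : φ₁ b ≠ φ₁ d := fun h => hbd (φ₁.injective h)
  have h1cd : φ₁ c ≠ φ₁ d := fun h => hcd (φ₁.injective h)
  set φ₂ := Equiv.swap (φ₁ b) 1 with hφ₂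
  have h2a : φ₂ 0 = 0 := Equiv.swap_apply_of_ne_of_ne h1b.symm (by decide)
  have h2b : φ₂ (φ₁ b) = 1 := Equiv.swap_apply_left _ _
  have h2c : φ₂ (φ₁ c) ≠ 0 := fun h => h1c (φ₂.injective (h.trans h2a.symm))
  have h2c1 : φ₂ (φ₁ c) ≠ 1 := fun h => h1bc (φ₂.injective (h2b.trans h.symm))
  have h2d : φ₂ (φ₁ d) ≠ 0 := fun h => h1d (φ₂.injective (h.trans h2a.symm))
  have h2d1 : φ₂ (φ₁ d) ≠ 1 := fun h => h1bd (φ₂.injective (h2b.trans h.symm))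
  have h2cd : φ₂ (φ₁ c) ≠ φ₂ (φ₁ d) := fun h => h1cd (φ₂.injective h)
  set φ₃ := Equiv.swap (φ₂ (φ₁ c)) 2 with hφ₃
  have h3a : φ₃ 0 = 0 := Equiv.swap_apply_of_ne_of_ne h2c.symm (by decide)
  have h3b : φ₃ 1 = 1 := Equiv.swap_apply_of_ne_of_ne h2c1.symm (by decide)
  have h3c : φ₃ (φ₂ (φ₁ c)) = 2 := Equiv.swap_apply_left _ _
  have h3d : φ₃ (φ₂ (φ₁ d)) ≠ 0 := fun h => h2d (φ₃.injective (h.trans h3a.symm))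
  have h3d1 : φ₃ (φ₂ (φ₁ d)) ≠ 1 := fun h => h2d1 (φ₃.injective (h.trans h3b.symm))
  have h3d2 : φ₃ (φ₂ (φ₁ d)) ≠ 2 := fun h => h2cd (φ₃.injective (h3c.trans h.symm))
  set φ₄ := Equiv.swap (φ₃ (φ₂ (φ₁ d))) 3 with hφ₄
  have h4a : φ₄ 0 = 0 := Equiv.swap_apply_of_ne_of_ne h3d.symm (by decide)
  have h4b : φ₄ 1 = 1 := Equiv.swap_apply_of_ne_of_ne h3d1.symm (by decide)
  have h4c : φ₄ 2 = 2 := Equiv.swap_apply_of_ne_of_ne h3d2.symm (by decide)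
  have h4d : φ₄ (φ₃ (φ₂ (φ₁ d))) = 3 := Equiv.swap_apply_left _ _
  refine ⟨?_, ?_, ?_, ?_⟩
  · rw [h1a, h2a, h3a, h4a]
  · rw [h2b, h3b, h4b]
  · rw [h3c, h4c]
  · exact h4d

/-! ### Coinciding marks -/

/-- A partition row separating two equal marks is the empty event. -/
theorem prob_partitionEvent_eq_zero_of_eq (G : MultiGraph V E) [Fintype E] [DecidableEq E]
    (p : E → ℝ) {k : ℕ} (m : Fin k → V) (rgs : Fin k → ℕ) {i j : Fin k} (hm : m i = m j)
    (hr : rgs i ≠ rgs j) : prob p (G.partitionEvent m rgs) = 0 := by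
  have : G.partitionEvent m rgs = ∅ := by
    ext ω
    simp only [partitionEvent, Set.mem_setOf_eq, Set.mem_empty_iff_false, iff_false, not_forall]
    refine ⟨i, j, fun h => hr (h.1 ?_)⟩
    rw [hm]
    exact Conn.refl G ω (m j)
  rw [this, prob_empty]

/-- C-005 holds whenever two of the four marks coincide (the left side vanishes). -/
theorem C005At_of_not_distinct (G : MultiGraph V E) [Fintype E] [DecidableEq E] (p : E → ℝ)
    (hp : IsProb p) (a b c d : V)
    (h : a = b ∨ a = c ∨ a = d ∨ b = c ∨ b = d ∨ c = d) : G.C005At p a b c d := by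
  unfold C005At
  have hRHS : 0 ≤ prob p (G.partitionEvent ![a, b, c, d] ![0, 0, 0, 0]) *
      prob p (G.partitionEvent ![a, b, c, d] ![0, 1, 2, 3]) :=
    mul_nonneg (prob_nonneg hp _) (prob_nonneg hp _)
  rcases h with h | h | h | h | h | h
  · rw [G.prob_partitionEvent_eq_zero_of_eq p ![a, b, c, d] ![0, 1, 0, 1] (i := 0) (j := 1) h
      (by decide), G.prob_partitionEvent_eq_zero_of_eq p ![a, b, c, d] ![0, 1, 1, 0] (i := 0)
      (j := 1) h (by decide)]
    linarith
  · rw [G.prob_partitionEvent_eq_zero_of_eq p ![a, b, c, d] ![0, 0, 1, 1] (i := 0) (j := 2) h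
      (by decide), G.prob_partitionEvent_eq_zero_of_eq p ![a, b, c, d] ![0, 1, 1, 0] (i := 0)
      (j := 2) h (by decide)]
    linarith
  · rw [G.prob_partitionEvent_eq_zero_of_eq p ![a, b, c, d] ![0, 0, 1, 1] (i := 0) (j := 3) h
      (by decide), G.prob_partitionEvent_eq_zero_of_eq p ![a, b, c, d] ![0, 1, 0, 1] (i := 0)
      (j := 3) h (by decide)]
    linarith
  · rw [G.prob_partitionEvent_eq_zero_of_eq p ![a, b, c, d] ![0, 0, 1, 1] (i := 1) (j := 2) h
      (by decide), G.prob_partitionEvent_eq_zero_of_eq p ![a, b, c, d] ![0, 1, 0, 1] (i := 1)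
      (j := 2) h (by decide)]
    linarith
  · rw [G.prob_partitionEvent_eq_zero_of_eq p ![a, b, c, d] ![0, 0, 1, 1] (i := 1) (j := 3) h
      (by decide), G.prob_partitionEvent_eq_zero_of_eq p ![a, b, c, d] ![0, 1, 1, 0] (i := 1)
      (j := 3) h (by decide)]
    linarith
  · rw [G.prob_partitionEvent_eq_zero_of_eq p ![a, b, c, d] ![0, 1, 0, 1] (i := 2) (j := 3) h
      (by decide), G.prob_partitionEvent_eq_zero_of_eq p ![a, b, c, d] ![0, 1, 1, 0] (i := 2)
      (j := 3) h (by decide)]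
    linarith

/-! ### The theorem for every choice of marks -/

/-- **C-005 for every simple graph on six vertices with at most ten edges, at every weight vector,
for every four marked vertices.** -/
theorem C005At_six_all_marks (k : ℕ) (hk : k ≤ 10) (G : MultiGraph (Fin 6) (Fin k))
    (hG : G.IsSimple) (p : Fin k → ℝ) (hp : IsProb p) (a b c d : Fin 6) :
    G.C005At p a b c d := by
  by_cases h : a = b ∨ a = c ∨ a = d ∨ b = c ∨ b = d ∨ c = d
  · exact G.C005At_of_not_distinct p hp a b c d h
  · simp only [not_or] at h
    obtain ⟨hab, hac, had, hbc, hbd, hcd⟩ := h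
    obtain ⟨ha, hb, hc, hd⟩ := markPerm_apply a b c d hab hac had hbc hbd hcd
    have key := C005At_six_of_card_le_ten k hk (G.relabelV (markPerm a b c d))
      (hG.relabelV _) p hp
    rw [← ha, ← hb, ← hc, ← hd, C005At_relabelV_iff] at key
    exact key

end MultiGraph

end PercRepro
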